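import Summits.KontsevichZagierPeriods.KontsevichZagierPeriods.Theorems.SoloInformedPellAbelQuarterLaw

/-!
# COROLLARY XXIX.5 bis: the order-two torsion packet is the simplest quarter turn

A second, homotopy-based proof of COROLLARY XXIX.5 (`SoloInformedKummerTorsionTwo`, which used the
pole-parameter involution): for `0 < k < 1` the NEGATIVE order-two packet `Π(−k | k²)` carries the
quarter-turn Pell–Abel unit

  `h = √Δ + i(1+k)t`,   `|h|² = Δ + (1+k)²t² = (1 + kt²)²`   (`Δ = (1−t²)(1−k²t²)`),

with `2(CB′ − C′B)Δ − CBΔ′ = 2(1+k)(1 − k²t⁴) = (2(1+k) − 2k(1+k)t²)(1 + kt²)`, so THEOREM XXXI′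
(`soloInformed_pellAbelQuarter_law`) applies with `q₀ = 2(1+k)`, `q₂ = −2k(1+k)`, `R = 1 + kt²`,
`n = −k`: `α = q₂/(q₂ + nq₀) = 1/2`, `β = n/(q₂ + nq₀) = 1/(4(1+k))`, i.e. for ALL representations

  `⟦Π(−k | k²)⟧ = ⟦[pt, 1/2]⟧·⟦K(k²)⟧ + ⟦[pt, 1/(4(1+k))]⟧·⟦π⟧`  in `P`,

the order-two law `4(1+k)Π = 2(1+k)K + π` of XXIX.5; and the CIRCULAR order-two packet `Π(k | k²)`
carries `h = √Δ + i(1−k)t`, `|h|² = (1 − kt²)²`, giving `Π(k | k²) = K/2 + π/(4(1−k))` (THEOREM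
XXIV's torsion value, there by one rule-(2) move).  Thus THEOREMS XXX (no turn), XXXI′ (quarter
turn) and XXXI (half turn) cover every torsion packet of order `≤ 4` of the Kummer family.

References: N. H. Abel (1826); A. M. Legendre, *Traité* I (1825); M. Kontsevich, D. Zagier,
*Periods* (2001), §1.2; this work.
-/

noncomputable section

open MeasureTheory Set Filter
open scoped Classical

open Literature.NumberTheory.Transcendental Literature.NumberTheory.Transcendental.KZ
open Literature.ModelTheory.ExponentialFields

namespace Summit.KontsevichZagierPeriods.KontsevichZagierPeriods.Theorems

/-! ### The order-two quarter-turn datum -/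

/-- Semialgebraicity of the (constant and linear) coefficient functions of the order-two unit.
[folklore] -/
theorem soloInformed_t2q_sa {c : ℝ} (hc : IsAlgebraic ℚ c) {S : Set (Fin 2 → ℝ)}
    (hS : IsSemialgebraic ℚ S) (i : Fin 2) :
    IsSemialgebraicFunOn ℚ S (fun _ : Fin 2 → ℝ => (1:ℝ)) ∧
    IsSemialgebraicFunOn ℚ S (fun _ : Fin 2 → ℝ => (0:ℝ)) ∧
    IsSemialgebraicFunOn ℚ S (fun w => c * w i) ∧
    IsSemialgebraicFunOn ℚ S (fun _ : Fin 2 → ℝ => c) := by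
  have ht : IsSemialgebraicFunOn ℚ S (fun w => w i) :=
    Literature.NumberTheory.Transcendental.isSemialgebraicFunOn_apply hS i
  have h1k : IsSemialgebraicFunOn ℚ S (fun _ : Fin 2 → ℝ => c) :=
    isSemialgebraicFunOn_const_of_isAlgebraic hS hc
  exact ⟨isSemialgebraicFunOn_const_of_isAlgebraic hS isAlgebraic_one,
    isSemialgebraicFunOn_const_of_isAlgebraic hS isAlgebraic_zero,
    (IsSemialgebraicFunOn.mul_holds h1k ht).congr fun w _ => by simp only [Pi.mul_apply], h1k⟩

/-- **The order-two quarter-turn Pell–Abel datum**: `m = k²`, `n = −k`, unit `√Δ + i(1+k)t`.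
[this work] -/
def soloInformedT2QDatum (k : ℝ) (hk0 : 0 < k) (hk1 : k < 1) (hka : IsAlgebraic ℚ k) :
    SoloInformedPellAbelQuarter where
  m := k ^ 2
  n := -k
  q₀ := 2 * (1 + k)
  q₂ := -(2 * k * (1 + k))
  C := fun _ => 1
  C' := fun _ => 0
  B := fun t => (1 + k) * t
  B' := fun _ => 1 + k
  R := fun t => 1 + k * t ^ 2
  m_mem := ⟨by positivity, by nlinarith⟩
  n_lt := by linarith
  m_isAlgebraic := hka.pow 2
  n_isAlgebraic := hka.neg
  q₀_isAlgebraic := by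
    have h2 : IsAlgebraic ℚ (2:ℝ) := by exact_mod_cast isAlgebraic_nat (R := ℚ) (A := ℝ) 2
    exact h2.mul (isAlgebraic_one.add hka)
  q₂_isAlgebraic := by
    have h2 : IsAlgebraic ℚ (2:ℝ) := by exact_mod_cast isAlgebraic_nat (R := ℚ) (A := ℝ) 2
    exact ((h2.mul hka).mul (isAlgebraic_one.add hka)).neg
  hasDerivAt_C := fun t => hasDerivAt_const t 1
  hasDerivAt_B := fun t => by
    simpa using (hasDerivAt_id' t).const_mul (1 + k)
  continuous_C' := by fun_prop
  continuous_B' := by fun_prop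
  norm := fun t => by ring
  num := fun t => by ring
  R_pos := fun t _ => by positivity
  C_zero := one_pos
  B_zero := by simp
  B_pos := fun t ht => mul_pos (by linarith) ht.1
  res := by
    have h : -(2 * k * (1 + k)) + -k * (2 * (1 + k)) = -(4 * k * (1 + k)) := by ring
    rw [h]
    exact neg_ne_zero.mpr (by positivity)
  sa_C := fun S hS i => (soloInformed_t2q_sa (isAlgebraic_one.add hka) hS i).1
  sa_C' := fun S hS i => (soloInformed_t2q_sa (isAlgebraic_one.add hka) hS i).2.1
  sa_B := fun S hS i => (soloInformed_t2q_sa (isAlgebraic_one.add hka) hS i).2.2.1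
  sa_B' := fun S hS i => (soloInformed_t2q_sa (isAlgebraic_one.add hka) hS i).2.2.2

/-- The datum's constants: `α = 1/2`, `β = 1/(4(1+k))`. [this work] -/
theorem soloInformed_t2q_alpha_beta {k : ℝ} (hk0 : 0 < k) (hk1 : k < 1) (hka : IsAlgebraic ℚ k) :
    (soloInformedT2QDatum k hk0 hk1 hka).alpha = 1 / 2 ∧
    (soloInformedT2QDatum k hk0 hk1 hka).beta = 1 / (4 * (1 + k)) := by
  have hk : (1 + k) ≠ 0 := by positivity
  have hk' : k ≠ 0 := hk0.ne'
  constructor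
  · show -(2 * k * (1 + k)) / (-(2 * k * (1 + k)) + -k * (2 * (1 + k))) = 1 / 2
    rw [div_eq_div_iff (by
      have : -(2 * k * (1 + k)) + -k * (2 * (1 + k)) = -(4 * k * (1 + k)) := by ring
      rw [this]; exact neg_ne_zero.mpr (by positivity)) two_ne_zero]
    ring
  · show -k / (-(2 * k * (1 + k)) + -k * (2 * (1 + k))) = 1 / (4 * (1 + k))
    rw [div_eq_div_iff (by
      have : -(2 * k * (1 + k)) + -k * (2 * (1 + k)) = -(4 * k * (1 + k)) := by ring
      rw [this]; exact neg_ne_zero.mpr (by positivity)) (by positivity)]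
    ring

/-- `1/2` and `1/(4(1+k))` are algebraic. [folklore] -/
theorem soloInformed_t2q_consts_isAlgebraic {k : ℝ} (hka : IsAlgebraic ℚ k) :
    IsAlgebraic ℚ ((1:ℝ) / 2) ∧ IsAlgebraic ℚ (1 / (4 * (1 + k))) := by
  have h2 : IsAlgebraic ℚ (2:ℝ) := by exact_mod_cast isAlgebraic_nat (R := ℚ) (A := ℝ) 2
  have h4 : IsAlgebraic ℚ (4:ℝ) := by exact_mod_cast isAlgebraic_nat (R := ℚ) (A := ℝ) 4
  refine ⟨?_, ?_⟩
  · rw [one_div]; exact h2.inv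
  · rw [one_div]; exact (h4.mul (isAlgebraic_one.add hka)).inv

/-! ### The circular order-two quarter-turn datum -/

/-- **The circular order-two quarter-turn Pell–Abel datum**: `m = k²`, `n = k`, unit `√Δ + i(1−k)t`
(`Δ + (1−k)²t² = (1 − kt²)²`). [this work] -/
def soloInformedT2CDatum (k : ℝ) (hk0 : 0 < k) (hk1 : k < 1) (hka : IsAlgebraic ℚ k) :
    SoloInformedPellAbelQuarter where
  m := k ^ 2
  n := k
  q₀ := 2 * (1 - k)
  q₂ := 2 * k * (1 - k)
  C := fun _ => 1
  C' := fun _ => 0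
  B := fun t => (1 - k) * t
  B' := fun _ => 1 - k
  R := fun t => 1 - k * t ^ 2
  m_mem := ⟨by positivity, by nlinarith⟩
  n_lt := hk1
  m_isAlgebraic := hka.pow 2
  n_isAlgebraic := hka
  q₀_isAlgebraic := by
    have h2 : IsAlgebraic ℚ (2:ℝ) := by exact_mod_cast isAlgebraic_nat (R := ℚ) (A := ℝ) 2
    exact h2.mul (isAlgebraic_one.sub hka)
  q₂_isAlgebraic := by
    have h2 : IsAlgebraic ℚ (2:ℝ) := by exact_mod_cast isAlgebraic_nat (R := ℚ) (A := ℝ) 2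
    exact (h2.mul hka).mul (isAlgebraic_one.sub hka)
  hasDerivAt_C := fun t => hasDerivAt_const t 1
  hasDerivAt_B := fun t => by
    simpa using (hasDerivAt_id' t).const_mul (1 - k)
  continuous_C' := by fun_prop
  continuous_B' := by fun_prop
  norm := fun t => by ring
  num := fun t => by ring
  R_pos := fun t ht => by nlinarith
  C_zero := one_pos
  B_zero := by simp
  B_pos := fun t ht => mul_pos (by linarith) ht.1
  res := by
    have h : 2 * k * (1 - k) + k * (2 * (1 - k)) = 4 * k * (1 - k) := by ring
    rw [h]
    have : 0 < 1 - k := by linarith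
    positivity
  sa_C := fun S hS i => (soloInformed_t2q_sa (isAlgebraic_one.sub hka) hS i).1
  sa_C' := fun S hS i => (soloInformed_t2q_sa (isAlgebraic_one.sub hka) hS i).2.1
  sa_B := fun S hS i => (soloInformed_t2q_sa (isAlgebraic_one.sub hka) hS i).2.2.1
  sa_B' := fun S hS i => (soloInformed_t2q_sa (isAlgebraic_one.sub hka) hS i).2.2.2

/-- The circular datum's constants: `α = 1/2`, `β = 1/(4(1−k))`. [this work] -/
theorem soloInformed_t2c_alpha_beta {k : ℝ} (hk0 : 0 < k) (hk1 : k < 1) (hka : IsAlgebraic ℚ k) :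
    (soloInformedT2CDatum k hk0 hk1 hka).alpha = 1 / 2 ∧
    (soloInformedT2CDatum k hk0 hk1 hka).beta = 1 / (4 * (1 - k)) := by
  have hk : 0 < 1 - k := by linarith
  have hd : 2 * k * (1 - k) + k * (2 * (1 - k)) ≠ 0 := by
    have : 2 * k * (1 - k) + k * (2 * (1 - k)) = 4 * k * (1 - k) := by ring
    rw [this]; positivity
  constructor
  · show 2 * k * (1 - k) / (2 * k * (1 - k) + k * (2 * (1 - k))) = 1 / 2
    rw [div_eq_div_iff hd two_ne_zero]
    ring
  · show k / (2 * k * (1 - k) + k * (2 * (1 - k))) = 1 / (4 * (1 - k))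
    rw [div_eq_div_iff hd (by positivity)]
    ring

/-- `1/2` and `1/(4(1−k))` are algebraic. [folklore] -/
theorem soloInformed_t2c_consts_isAlgebraic {k : ℝ} (hka : IsAlgebraic ℚ k) :
    IsAlgebraic ℚ ((1:ℝ) / 2) ∧ IsAlgebraic ℚ (1 / (4 * (1 - k))) := by
  have h2 : IsAlgebraic ℚ (2:ℝ) := by exact_mod_cast isAlgebraic_nat (R := ℚ) (A := ℝ) 2
  have h4 : IsAlgebraic ℚ (4:ℝ) := by exact_mod_cast isAlgebraic_nat (R := ℚ) (A := ℝ) 4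
  refine ⟨?_, ?_⟩
  · rw [one_div]; exact h2.inv
  · rw [one_div]; exact (h4.mul (isAlgebraic_one.sub hka)).inv

/-! ### COROLLARY XXIX.5 bis -/

/-- **COROLLARY XXIX.5 bis (the order-two packet by the quarter-turn theorem).** For real
algebraic `0 < k < 1` and ALL representations `Π = [(0,1), κ_{k²}/(1+kx²)]`, `K = [(0,1), κ_{k²}]`:
`⟦Π⟧ = ⟦[pt, 1/2]⟧·⟦K⟧ + ⟦[pt, 1/(4(1+k))]⟧·⟦π⟧` in `P`. [this work] -/
theorem soloInformed_kummer_torsionTwo_quarter (k : ℝ) (hk0 : 0 < k) (hk1 : k < 1)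
    (hka : IsAlgebraic ℚ k) (PN K : IntegralRep 1)
    (hPNd : PN.domain = {x | x 0 ∈ Ioo (0:ℝ) 1})
    (hPNi : EqOn PN.integrand (fun x => (1 + k * x 0 ^ 2)⁻¹ *
      ((√(1 - x 0 ^ 2))⁻¹ * (√(1 - k ^ 2 * x 0 ^ 2))⁻¹)) PN.domain)
    (hKd : K.domain = {x | x 0 ∈ Ioo (0:ℝ) 1})
    (hKi : EqOn K.integrand (fun x => (√(1 - x 0 ^ 2))⁻¹ * (√(1 - k ^ 2 * x 0 ^ 2))⁻¹)
      K.domain) :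
    toFormalPeriod (of PN) =
      toFormalPeriod (of (IntegralRep.unit.constMul ((1:ℝ) / 2)
        (soloInformed_t2q_consts_isAlgebraic hka).1)) * toFormalPeriod (of K) +
      toFormalPeriod (of (IntegralRep.unit.constMul (1 / (4 * (1 + k)))
        (soloInformed_t2q_consts_isAlgebraic hka).2)) * toFormalPeriod (of piRep) := by
  obtain ⟨hα, hβ⟩ := soloInformed_t2q_alpha_beta hk0 hk1 hka
  have h := soloInformed_pellAbelQuarter_law (soloInformedT2QDatum k hk0 hk1 hka) PN K hPNd
    (fun x hx => (hPNi hx).trans (by simp only [soloInformedT2QDatum]; ring)) hKd hKi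
  rw [h, soloInformed_pointRep_congr _ (soloInformed_t2q_consts_isAlgebraic hka).1 hα,
    soloInformed_pointRep_congr _ (soloInformed_t2q_consts_isAlgebraic hka).2 hβ]

/-- **COROLLARY XXIX.5 bis, in values**: `Π(−k | k²) = K(k²)/2 + π/(4(1+k))`. [this work] -/
theorem soloInformed_kummer_torsionTwo_quarter_value (k : ℝ) (hk0 : 0 < k) (hk1 : k < 1)
    (hka : IsAlgebraic ℚ k) (PN K : IntegralRep 1)
    (hPNd : PN.domain = {x | x 0 ∈ Ioo (0:ℝ) 1})
    (hPNi : EqOn PN.integrand (fun x => (1 + k * x 0 ^ 2)⁻¹ *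
      ((√(1 - x 0 ^ 2))⁻¹ * (√(1 - k ^ 2 * x 0 ^ 2))⁻¹)) PN.domain)
    (hKd : K.domain = {x | x 0 ∈ Ioo (0:ℝ) 1})
    (hKi : EqOn K.integrand (fun x => (√(1 - x 0 ^ 2))⁻¹ * (√(1 - k ^ 2 * x 0 ^ 2))⁻¹)
      K.domain) :
    PN.value = 1 / 2 * K.value + 1 / (4 * (1 + k)) * Real.pi := by
  have h := congrArg evalP
    (soloInformed_kummer_torsionTwo_quarter k hk0 hk1 hka PN K hPNd hPNi hKd hKi)
  simpa only [map_mul, map_add, evalP_toFormalPeriod_of, IntegralRep.value_constMul,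
    IntegralRep.value_unit, mul_one, piRep_value] using h

/-- **The fibre `k = 1/2`**: `6·Π(−1/2 | 1/4) = 3·K(1/4) + π` for all representations.
[this work] -/
theorem soloInformed_kummer_torsionTwo_quarter_fibre (PN K : IntegralRep 1)
    (hPNd : PN.domain = {x | x 0 ∈ Ioo (0:ℝ) 1})
    (hPNi : EqOn PN.integrand (fun x => (1 + 1 / 2 * x 0 ^ 2)⁻¹ *
      ((√(1 - x 0 ^ 2))⁻¹ * (√(1 - 1 / 4 * x 0 ^ 2))⁻¹)) PN.domain)
    (hKd : K.domain = {x | x 0 ∈ Ioo (0:ℝ) 1})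
    (hKi : EqOn K.integrand (fun x => (√(1 - x 0 ^ 2))⁻¹ * (√(1 - 1 / 4 * x 0 ^ 2))⁻¹)
      K.domain) :
    6 * PN.value = 3 * K.value + Real.pi := by
  have h2 : IsAlgebraic ℚ ((1:ℝ) / 2) := by
    rw [one_div]
    exact (show IsAlgebraic ℚ (2:ℝ) by exact_mod_cast isAlgebraic_nat (R := ℚ) (A := ℝ) 2).inv
  have hq : ((1:ℝ) / 2) ^ 2 = 1 / 4 := by norm_num
  have h := soloInformed_kummer_torsionTwo_quarter_value (1 / 2) (by norm_num) (by norm_num) h2 PN K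
    hPNd (by rw [hq]; exact hPNi) hKd (by rw [hq]; exact hKi)
  rw [h]
  ring

/-- **COROLLARY XXIX.5 ter (the circular order-two packet by the quarter-turn theorem)** — a
second proof of THEOREM XXIV's torsion value (`soloInformed_ellipticPi_torsion`, one rule-(2) move):
for real algebraic `0 < k < 1` and ALL representations `Π = [(0,1), κ_{k²}/(1−kx²)]`,
`K = [(0,1), κ_{k²}]`: `⟦Π⟧ = ⟦[pt, 1/2]⟧·⟦K⟧ + ⟦[pt, 1/(4(1−k))]⟧·⟦π⟧` in `P`. [this work] -/
theorem soloInformed_kummer_torsionTwoCirc_quarter (k : ℝ) (hk0 : 0 < k) (hk1 : k < 1)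
    (hka : IsAlgebraic ℚ k) (PN K : IntegralRep 1)
    (hPNd : PN.domain = {x | x 0 ∈ Ioo (0:ℝ) 1})
    (hPNi : EqOn PN.integrand (fun x => (1 - k * x 0 ^ 2)⁻¹ *
      ((√(1 - x 0 ^ 2))⁻¹ * (√(1 - k ^ 2 * x 0 ^ 2))⁻¹)) PN.domain)
    (hKd : K.domain = {x | x 0 ∈ Ioo (0:ℝ) 1})
    (hKi : EqOn K.integrand (fun x => (√(1 - x 0 ^ 2))⁻¹ * (√(1 - k ^ 2 * x 0 ^ 2))⁻¹)
      K.domain) :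
    toFormalPeriod (of PN) =
      toFormalPeriod (of (IntegralRep.unit.constMul ((1:ℝ) / 2)
        (soloInformed_t2c_consts_isAlgebraic hka).1)) * toFormalPeriod (of K) +
      toFormalPeriod (of (IntegralRep.unit.constMul (1 / (4 * (1 - k)))
        (soloInformed_t2c_consts_isAlgebraic hka).2)) * toFormalPeriod (of piRep) := by
  obtain ⟨hα, hβ⟩ := soloInformed_t2c_alpha_beta hk0 hk1 hka
  have h := soloInformed_pellAbelQuarter_law (soloInformedT2CDatum k hk0 hk1 hka) PN K hPNd hPNi
    hKd hKi
  rw [h, soloInformed_pointRep_congr _ (soloInformed_t2c_consts_isAlgebraic hka).1 hα,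
    soloInformed_pointRep_congr _ (soloInformed_t2c_consts_isAlgebraic hka).2 hβ]

/-- **COROLLARY XXIX.5 ter, in values**: `Π(k | k²) = K(k²)/2 + π/(4(1−k))`. [this work] -/
theorem soloInformed_kummer_torsionTwoCirc_quarter_value (k : ℝ) (hk0 : 0 < k) (hk1 : k < 1)
    (hka : IsAlgebraic ℚ k) (PN K : IntegralRep 1)
    (hPNd : PN.domain = {x | x 0 ∈ Ioo (0:ℝ) 1})
    (hPNi : EqOn PN.integrand (fun x => (1 - k * x 0 ^ 2)⁻¹ *
      ((√(1 - x 0 ^ 2))⁻¹ * (√(1 - k ^ 2 * x 0 ^ 2))⁻¹)) PN.domain)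
    (hKd : K.domain = {x | x 0 ∈ Ioo (0:ℝ) 1})
    (hKi : EqOn K.integrand (fun x => (√(1 - x 0 ^ 2))⁻¹ * (√(1 - k ^ 2 * x 0 ^ 2))⁻¹)
      K.domain) :
    PN.value = 1 / 2 * K.value + 1 / (4 * (1 - k)) * Real.pi := by
  have h := congrArg evalP
    (soloInformed_kummer_torsionTwoCirc_quarter k hk0 hk1 hka PN K hPNd hPNi hKd hKi)
  simpa only [map_mul, map_add, evalP_toFormalPeriod_of, IntegralRep.value_constMul,
    IntegralRep.value_unit, mul_one, piRep_value] using h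

end Summit.KontsevichZagierPeriods.KontsevichZagierPeriods.Theorems

end
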